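import Summits.Ventures.GridStability.Lyapunov.NE39LossySplitLinesU7o500SlabCertCross
import Summits.Ventures.GridStability.Lyapunov.StructurePreservingLevelBound
import Literature.MathematicalPhysics.PowerSystems.LuriePostnikovSlabSchurForm
import Summits.Ventures.GridStability.Lyapunov.NE39LossySplitLinesRecDual
import HarnessLib

/-!
# «NE39-LOSSY-SPLITU-RECORD-TIGHT» — an exact certificate of the CLASS OF RECORD on the UNORDERED-LINES split presentation of the
# lossy 39-bus 10-machine Kron model at the window `2·arctan(7/500)` (≈ 1.604°), by lit-6's SCHUR FORM, and THE TIGHTENED RECORD BRACKET (seat g11)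

Cell `gridfusion` (LADDER-GRIDFUSION G2.c lossy Lur'e tier — the 39-bus rung of memo §4's benchmark ladder); seat
gridfusion-lit-6 (g11; g10's generator with the record-window TAG patch `probes/rectight/gen_ne39_lean_v2.py`).  THIS FILE = the class-of-record chain `NE39LossySplitLinesSlabCert` (p604368, window `2·arctan(1/100)`, ★ #210) RE-INSTANTIATED at the
LARGEST class-of-record window whose certificate rounds exactly, `2·arctan(7/500)` ≈ 1.604°, to TIGHTEN the record bracket of ★ #210 /
★ #203 from [1.146°, 1.719°) to [1.604°, 1.719°) (names carry the chain suffix `₄`).  Pipeline recap — the K2A pipeline (`K2ALossySplitLinesLPCert`, p582933) carried to `S = NE39.splitLurieLinesSystem`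
(`Models/NE39SplitLurieLines.lean`: lit-6's unordered-lines split Lur'e system of model-4's `NE39.preLossless.toModelRel (1/10) 0` —
New-England 39-bus data Kron-reduced to the 10 machine internal nodes WITH transfer conductances, ASSUMED uniform damping ratio
`λ = 1/10`; states `Fin 10 ⊕ Fin 9`, channels `(Fin 10 × Fin 10) ⊕ (Fin 10 × Fin 10)` = one SINE and one COSINE channel per ORDERED
pair; the 180 channels `p ≠ q` carry multipliers, the 20 diagonal channels have `C_k = 0`), with ONE new device: the certificate
matrix `−𝓛` (`219 × 219`) is NOT decided monolithically.  Since `C·B = 0` (`NE39LossySplitLines.C_mul_B`) and every `τ_k > 0`,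
lit-6's `LuriePostnikovSlabSchurForm` (p585320) reduces `−𝓛 ⪰ 0` to the `19 × 19` SCHUR COMPLEMENT
`−L₁₁ − L₁₂·diag(τ)⁻¹·L₁₂ᵀ ⪰ 0`, decided here by ONE kernel `LDLᵀ` (`schur_ldl₄`) on the formula assembled from TABULATED blocks
(`L11lit`, `L12tab`, data files A/B) whose every entry is re-decided against lit-6's block formulas (`L11lit_eq₄`, `L12lit_eq₄`:
`L₁₁ = AᵀP + PA + η·1 − Cᵀdiag(τab)C`, `L₁₂ = −PB + (CA)ᵀdiag(λ) + Cᵀdiag(τ(a+b)/2)` entrywise over `ℚ`), and cast to the typed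
object (`schur_eq`).

WHAT IS PROVED.  (1) `slabCert : SlabCertificate NE39.splitLurieLinesSystem` (lit-6's `SlabCertificate.ofSchur`; the class OF RECORD of
«LOSSY-LURIE» / ★ #168's `.toLP` comparison): `P` dyadic `2^-20` with `P ⪰ ε·1` (`P_ldl₄`, 19 × 19 kernel `LDLᵀ`),
`ε = 1/131072`, `η = 1/65536`, `τ > 0`, `λ ≥ 0` with the sign rule `λ_k > 0 → a_k ≥ 0` DECIDED (`multL₄`; `λ > 0` on
56 channels, all with `a ≥ 0`), OUTER dyadic sector slopes on every ordered pair `p ≠ q` as in the positivity files;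
the `19 × 19` Schur complement by ONE kernel `LDLᵀ` (`schur_ldl₄`).  (2) `hsecL` — the sector hypothesis on
`|ξ − δ*_k| ≤ 2·arctan(7/500)`, all 200 channels.  (3) `slabSplitClass_nonempty_NE39` — the class of record is NON-EMPTY at
`2·arctan(7/500)` on `S`; (4) `splitBrackets_tight_NE39` — with lit-6's three other NE39 split files: record-class optimum
∈ [1.604°, 1.719°], positivity-class optimum ∈ [1.719°, 1.862°] (suprema of certifiable windows, CLOSED brackets per the ★ #210 word w1;
certificate CLASSES on one MODEL; no region statement here).

PRODUCER (not trusted; everything re-decided here): lit-6 g11 kit j300200 (`probes/splitgen/splitu_generic.py` JOB_SYSTEM=NE39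
JOB_MODE=primal JOB_ACT=pairs JOB_TAUFLOOR=1; output `splitu_NE39_primal_lam1o10_pairs.json` sha16 `2cb57f81555fc29f`, results[u0 = 7/500,
klass = old]): max-margin class-of-record SDP (CLARABEL, `ν* ≈ 4.91e-05`), dyadic rounding `2^-20`, exact `Fraction` re-check
(`P − ε·1` min pivot `4.34e-05` — the class fact `P_ldl₄`; `P + Cᵀdiag(λa)C − ε·1` min pivot `4.52e-03`, carried, unused by this class;
Schur complement min pivot `8.30e-05`); tables by `probes/rectight/gen_ne39_lean_v2.py` (= g10's `probes/ne39/gen_ne39_lean.py` + TAG patch; regression-identical on the landed chains).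
VALIDATED (floats, CLARABEL; kit j300045 / j300140 / j300200, jsons `probes/rectight/`): the class-of-record primal margin is `ν* > 0` at
`u = 9/800, 1/80, 11/800, 7/500` (exact certificates rounded at all four, den `2^20`; THIS FILE types the largest, `7/500`) and `ν* < 0` at
`57/4000` (1.633°), `229/16000`, `23/1600`, `47/3200`, `59/4000` — by floats the record optimum lies in (1.604°, 1.633°); CERTIFIED are only
«non-empty at 2·arctan(7/500)» (here) and «empty at every window ≥ 2·arctan(3/200)» (`NE39LossySplitLinesRecDual`).  THREE COLUMNS.  CERTIFIED (kernel): the identities, the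
certificate's defining facts and the class statement for the MODEL; nothing about the 39-bus system or any grid.  MODELLED: as
`Models/NE39SplitLurieLines` / model-4's record.  VALIDATED: the solver lineage and margins above.
[cite: Khalil2002, §7.1 Example 7.5, §7.1.2 Theorem 7.3; Pai1981, §2.16 (2.63)–(2.64), §3.6.3 (3.43)–(3.45), §4.6 p. 117; HornJohnson2013, Thm 7.7.7; BoydVandenberghe2004, §5.9.4]
-/

noncomputable section

open Real Matrix
open Literature.Computation.Certificates
open Literature.MathematicalPhysics.PowerSystems
open Literature.MathematicalPhysics.PowerSystems.LyapunovFunctionFamily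
open Summit.Ventures.GridStability.Models
open Summit.Ventures.GridStability.Bench.WSCC9LossySplitSlab (sector_sin_of_values sector_cos_of_values)
open Summit.Ventures.GridStability.Lyapunov.K2ALossySplitLines (sector_sin_of_values_wide)
open Summit.Ventures.GridStability.Lyapunov.NE39LossySplitLines (e1 AQ CQ BLQ A_eq B_eq C_eq C_mul_B)

namespace Summit.Ventures.GridStability.Lyapunov.NE39LossySplitLinesU7o500SlabCert

/-! ### The Schur complement is positive semidefinite (kernel `LDLᵀ`, file 3 of 3) -/

set_option maxHeartbeats 400000000 in
/-- **The Schur complement `−L₁₁ − L₁₂·diag(τ)⁻¹·L₁₂ᵀ ⪰ 0`** (19 × 19, kernel `LDLᵀ` on the formula over the tables; this one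
decision replaces the `219 × 219` fact `−𝓛 ⪰ 0`). -/
theorem schur_ldl₄ : PSD.LDLCert SchF₄ := by
  decide +kernel

/-! ### The certificate data over `ℝ` and the cast identities -/

/-- `P` (real). -/
def Pr : Matrix (Fin 10 ⊕ Fin 9) (Fin 10 ⊕ Fin 9) ℝ := PL₄.map (Rat.cast : ℚ → ℝ)
/-- `τ` (real). -/
def τr : (Fin 10 × Fin 10) ⊕ (Fin 10 × Fin 10) → ℝ := fun k => (tauL₄ k : ℝ)
/-- `λ` (real). -/
def lamr : (Fin 10 × Fin 10) ⊕ (Fin 10 × Fin 10) → ℝ := fun k => (lamL₄ k : ℝ)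
/-- `a` (real). -/
def ar : (Fin 10 × Fin 10) ⊕ (Fin 10 × Fin 10) → ℝ := fun k => (aL₄ k : ℝ)
/-- `b` (real). -/
def br : (Fin 10 × Fin 10) ⊕ (Fin 10 × Fin 10) → ℝ := fun k => (bL₄ k : ℝ)

/-- `(M·N) ↦ ℝ` (plumbing). -/
private theorem map_mul' {m n o : Type*} [Fintype n] (M : Matrix m n ℚ) (N : Matrix n o ℚ) :
    (M * N).map (Rat.cast : ℚ → ℝ) = M.map (Rat.cast : ℚ → ℝ) * N.map (Rat.cast : ℚ → ℝ) :=
  Matrix.map_mul (f := Rat.castHom ℝ)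
/-- `(M + N) ↦ ℝ` (plumbing). -/
private theorem map_add' {m n : Type*} (M N : Matrix m n ℚ) :
    (M + N).map (Rat.cast : ℚ → ℝ) = M.map (Rat.cast : ℚ → ℝ) + N.map (Rat.cast : ℚ → ℝ) := by
  ext; simp
/-- `(M − N) ↦ ℝ` (plumbing). -/
private theorem map_sub' {m n : Type*} (M N : Matrix m n ℚ) :
    (M - N).map (Rat.cast : ℚ → ℝ) = M.map (Rat.cast : ℚ → ℝ) - N.map (Rat.cast : ℚ → ℝ) := by
  ext; simp
/-- `(−M) ↦ ℝ` (plumbing). -/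
private theorem map_neg' {m n : Type*} (M : Matrix m n ℚ) :
    (-M).map (Rat.cast : ℚ → ℝ) = -M.map (Rat.cast : ℚ → ℝ) := by
  ext; simp
/-- `Mᵀ ↦ ℝ` (plumbing). -/
private theorem map_transpose' {m n : Type*} (M : Matrix m n ℚ) :
    Mᵀ.map (Rat.cast : ℚ → ℝ) = (M.map (Rat.cast : ℚ → ℝ))ᵀ := by
  ext; simp
/-- `diagonal d ↦ ℝ` (plumbing). -/
private theorem map_diagonal' {n : Type*} [DecidableEq n] (d : n → ℚ) :
    (Matrix.diagonal d).map (Rat.cast : ℚ → ℝ) = Matrix.diagonal (fun i => ((d i : ℚ) : ℝ)) :=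
  Matrix.diagonal_map (Rat.cast_zero)
/-- `q • 1 ↦ ℝ` (plumbing). -/
private theorem map_smul_one' {n : Type*} [DecidableEq n] (q : ℚ) :
    (q • (1 : Matrix n n ℚ)).map (Rat.cast : ℚ → ℝ) = ((q : ℚ) : ℝ) • (1 : Matrix n n ℝ) := by
  ext i j; by_cases h : i = j <;> simp [h]

/-- State block identity. -/
private theorem L11_eq : slabL11 NE39.splitLurieLinesSystem Pr (etaLQ : ℝ) τr ar br = LL11Q₄.map (Rat.cast : ℚ → ℝ) := by
  have hd : Matrix.diagonal (fun k => τr k * (ar k * br k))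
      = (Matrix.diagonal (fun k => tauL₄ k * (aL₄ k * bL₄ k))).map (Rat.cast : ℚ → ℝ) := by
    rw [map_diagonal']
    congr 1; funext k; simp [τr, ar, br]
  rw [slabL11, A_eq, C_eq, hd, Pr, LL11Q₄]
  simp only [map_sub', map_add', map_mul', map_transpose', map_smul_one']

/-- Cross block identity. -/
private theorem L12_eq : slabL12 NE39.splitLurieLinesSystem Pr lamr τr ar br = LL12Q₄.map (Rat.cast : ℚ → ℝ) := by
  have hd1 : Matrix.diagonal lamr = (Matrix.diagonal lamL₄).map (Rat.cast : ℚ → ℝ) := by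
    rw [map_diagonal']; rfl
  have hd2 : Matrix.diagonal (fun k => τr k * (ar k + br k) / 2)
      = (Matrix.diagonal (fun k => tauL₄ k * (aL₄ k + bL₄ k) / 2)).map (Rat.cast : ℚ → ℝ) := by
    rw [map_diagonal']
    congr 1; funext k; simp [τr, ar, br]
  rw [slabL12, A_eq, B_eq, C_eq, hd1, hd2, Pr, LL12Q₄]
  simp only [map_add', map_neg', map_mul', map_transpose']

/-- **The Schur complement over `ℝ` is the cast of `SchurQ₄`.** -/
theorem schur_eq : slabSchur NE39.splitLurieLinesSystem Pr (etaLQ : ℝ) lamr τr ar br = SchurQ₄.map (Rat.cast : ℚ → ℝ) := by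
  have hd : Matrix.diagonal (fun k => (τr k)⁻¹) = (Matrix.diagonal (fun k => (tauL₄ k)⁻¹)).map (Rat.cast : ℚ → ℝ) := by
    rw [map_diagonal']
    congr 1; funext k; simp [τr]
  rw [slabSchur, L11_eq, L12_eq, hd, SchurQ₄]
  simp only [map_sub', map_neg', map_mul', map_transpose']

/-- **`P − ε·1` over `ℝ` is the cast of `PL − ε·1`.** -/
theorem P_shift_eq : Pr - (epsLQ : ℝ) • (1 : Matrix (Fin 10 ⊕ Fin 9) (Fin 10 ⊕ Fin 9) ℝ)
    = (PL₄ - epsLQ • (1 : Matrix (Fin 10 ⊕ Fin 9) (Fin 10 ⊕ Fin 9) ℚ)).map (Rat.cast : ℚ → ℝ) := by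
  rw [Pr]
  simp only [map_sub', map_smul_one']

/-- `P − ε·1 ⪰ 0` over `ℝ` (from the kernel `LDLᵀ` on the literal, reindexed). -/
private theorem P_ge_psd : (Pr - (epsLQ : ℝ) • (1 : Matrix (Fin 10 ⊕ Fin 9) (Fin 10 ⊕ Fin 9) ℝ)).PosSemidef := by
  rw [P_shift_eq, PShift_sub₄]
  exact (P_ldl₄.posSemidef (R := ℝ)).submatrix e1

/-- **The Schur complement is positive semidefinite** over `ℝ`. -/
theorem schur_psd : (slabSchur NE39.splitLurieLinesSystem Pr (etaLQ : ℝ) lamr τr ar br).PosSemidef := by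
  rw [schur_eq, SchurQ_eq_F₄]
  exact (schur_ldl₄.posSemidef (R := ℝ)).submatrix e1

/-! ### The certificate -/

/-- **An exact certificate of the CLASS OF RECORD (`SlabCertificate`: `P ⪰ ε·1`, Popov terms only where `a ≥ 0`) on the
unordered-lines split presentation of the lossy 39-bus model at `2·arctan(7/500)`**, assembled by lit-6's Schur-form
constructor (`C·B = 0`, `τ > 0`, Schur complement `⪰ 0`).
[cite: Pai1981, §2.16 Theorem [18] eqs. (2.63)–(2.64), §3.6.3 (3.43)–(3.45); Khalil2002, §7.1 Example 7.5; HornJohnson2013, Thm 7.7.7] -/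
def slabCert : SlabCertificate NE39.splitLurieLinesSystem :=
  SlabCertificate.ofSchur NE39.splitLurieLinesSystem C_mul_B Pr (epsLQ : ℝ) (etaLQ : ℝ) τr lamr ar br
    (by
      show (PL₄.map (Rat.cast : ℚ → ℝ))ᵀ = PL₄.map (Rat.cast : ℚ → ℝ)
      rw [← map_transpose', PL_transpose₄])
    (by exact_mod_cast (by norm_num [epsLQ] : (0 : ℚ) < epsLQ)) (by exact_mod_cast (by norm_num [etaLQ] : (0 : ℚ) < etaLQ))
    P_ge_psd
    (fun k => by unfold τr; exact_mod_cast (multL₄ k).1)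
    (fun k => by unfold lamr; exact_mod_cast (multL₄ k).2.1)
    (fun k hk => by
      unfold lamr at hk; unfold ar
      exact_mod_cast (multL₄ k).2.2 (by exact_mod_cast hk))
    schur_psd

/-- The certificate's slopes are the literals (definitional). -/
theorem slabCert_a_b (k : (Fin 10 × Fin 10) ⊕ (Fin 10 × Fin 10)) : slabCert.a k = ((aL₄ k : ℚ) : ℝ) ∧ slabCert.b k = ((bL₄ k : ℚ) : ℝ) := ⟨rfl, rfl⟩

/-! ### The sector hypothesis at `γ = 2·arctan(7/500)` -/

/-- `cos γ = 249951/250049` and `sin γ = 7000/250049` for `γ = 2·arctan(7/500)`. -/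
theorem cos_sin_γL : Real.cos (2 * Real.arctan (7 / 500 : ℝ)) = ((249951/250049 : ℚ) : ℝ) ∧
    Real.sin (2 * Real.arctan (7 / 500 : ℝ)) = ((7000/250049 : ℚ) : ℝ) := by
  rw [Lyapunov.StructurePreserving.cos_two_mul_arctan, Lyapunov.StructurePreserving.sin_two_mul_arctan]
  constructor <;> push_cast <;> norm_num

/-- `0 ≤ γ < π/2`. -/
theorem γL_range : 0 ≤ 2 * Real.arctan (7 / 500 : ℝ) ∧ 2 * Real.arctan (7 / 500 : ℝ) < π / 2 :=
  ⟨Lyapunov.StructurePreserving.two_mul_arctan_nonneg (by norm_num),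
    Lyapunov.StructurePreserving.two_mul_arctan_lt_pi_div_two (by norm_num)⟩

/-- DIAGONAL channels (`p = q`, `C_k = 0`) carry the trivial sector `[−1, 1]` (kernel). -/
theorem null_slopesL₄ : ∀ p : Fin 10,
    aL₄ (Sum.inl (p, p)) = -1 ∧ bL₄ (Sum.inl (p, p)) = 1 ∧ aL₄ (Sum.inr (p, p)) = -1 ∧ bL₄ (Sum.inr (p, p)) = 1 := by
  decide +kernel

set_option maxHeartbeats 4000000 in
/-- **Sine-channel tests at `(cos γ, sin γ) = (249951, 7000)/250049`** for every ordered pair `p ≠ q`: EITHER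
the narrow form `sin γ ≤ |sd| ∧ a ≤ cd·cos γ − |sd|·sin γ ∧ cd·cos γ + |sd|·sin γ ≤ b` OR the wide form
`a ≤ cd·cos γ − |sd|·sin γ ∧ 1 ≤ b` (kernel, outer dyadic slopes). -/
theorem sine_testsL₄ : ∀ p q : Fin 10, p ≠ q →
    ((7000/250049 : ℚ) ≤ |NE39.preLossless.sd p q| ∧
      aL₄ (Sum.inl (p, q)) ≤ NE39.preLossless.cd p q * (249951/250049) - |NE39.preLossless.sd p q| * (7000/250049) ∧
      NE39.preLossless.cd p q * (249951/250049) + |NE39.preLossless.sd p q| * (7000/250049) ≤ bL₄ (Sum.inl (p, q))) ∨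
    (aL₄ (Sum.inl (p, q)) ≤ NE39.preLossless.cd p q * (249951/250049) - |NE39.preLossless.sd p q| * (7000/250049) ∧
      1 ≤ bL₄ (Sum.inl (p, q))) := by
  decide +kernel

set_option maxHeartbeats 4000000 in
/-- **Cosine-channel tests** for every ordered pair `p ≠ q`: `sin γ ≤ cd`, `a ≤ −(sd·cos γ + cd·sin γ)`,
`−(sd·cos γ − cd·sin γ) ≤ b` (kernel). -/
theorem cosine_testsL₄ : ∀ p q : Fin 10, p ≠ q →
    (7000/250049 : ℚ) ≤ NE39.preLossless.cd p q ∧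
      aL₄ (Sum.inr (p, q)) ≤ -(NE39.preLossless.sd p q * (249951/250049) + NE39.preLossless.cd p q * (7000/250049)) ∧
      -(NE39.preLossless.sd p q * (249951/250049) - NE39.preLossless.cd p q * (7000/250049)) ≤ bL₄ (Sum.inr (p, q)) := by
  decide +kernel

/-- **`hsecL`**: on the window `|ξ − δ*_k| ≤ 2·arctan(7/500)` every channel's cosine lies in `[a_k, b_k]`. -/
theorem hsecL : ∀ k ξ, |ξ - NE39.splitLurieLinesSystem.δs k| ≤ 2 * Real.arctan (7 / 500 : ℝ) →
    slabCert.a k ≤ Real.cos ξ ∧ Real.cos ξ ≤ slabCert.b k := by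
  rintro (⟨p, q⟩ | ⟨p, q⟩) ξ hξ
  · rw [(slabCert_a_b _).1, (slabCert_a_b _).2]
    change |ξ - (NE39.preLossless.angleOf p - NE39.preLossless.angleOf q)| ≤ _ at hξ
    by_cases hpq : p = q
    · subst hpq
      obtain ⟨h1, h2, -, -⟩ := null_slopesL₄ p
      rw [h1, h2]; push_cast
      exact ⟨Real.neg_one_le_cos ξ, Real.cos_le_one ξ⟩
    · rcases sine_testsL₄ p q hpq with ⟨t1, t2, t3⟩ | ⟨t2, t3⟩
      · refine sector_sin_of_values (NE39.abs_angle_sub_lt p q) γL_range.1 γL_range.2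
          (NE39.sin_angleOf_sub p q) (NE39.cos_angleOf_sub p q) cos_sin_γL.1 cos_sin_γL.2 ?_ ?_ ?_ ξ hξ
        · rw [← Rat.cast_abs]; exact_mod_cast t1
        · rw [← Rat.cast_abs]; exact_mod_cast t2
        · rw [← Rat.cast_abs]; exact_mod_cast t3
      · refine sector_sin_of_values_wide (NE39.abs_angle_sub_lt p q) γL_range.1 γL_range.2
          (NE39.sin_angleOf_sub p q) (NE39.cos_angleOf_sub p q) cos_sin_γL.1 cos_sin_γL.2 ?_ ?_ ξ hξ
        · rw [← Rat.cast_abs]; exact_mod_cast t2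
        · exact_mod_cast t3
  · rw [(slabCert_a_b _).1, (slabCert_a_b _).2]
    change |ξ - (NE39.preLossless.angleOf p - NE39.preLossless.angleOf q + π / 2)| ≤ _ at hξ
    by_cases hpq : p = q
    · subst hpq
      obtain ⟨-, -, h1, h2⟩ := null_slopesL₄ p
      rw [h1, h2]; push_cast
      exact ⟨Real.neg_one_le_cos ξ, Real.cos_le_one ξ⟩
    · obtain ⟨t1, t2, t3⟩ := cosine_testsL₄ p q hpq
      refine sector_cos_of_values (NE39.abs_angle_sub_lt p q) γL_range.2.le (NE39.sin_angleOf_sub p q)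
        (NE39.cos_angleOf_sub p q) cos_sin_γL.1 cos_sin_γL.2 ?_ ?_ ?_ ξ hξ
      · exact_mod_cast t1
      · exact_mod_cast t2
      · exact_mod_cast t3

/-! ### THE CLASS STATEMENT -/

/-- **The CLASS OF RECORD on the unordered-lines split presentation of the lossy 39-bus model is NON-EMPTY at
`2·arctan(7/500)`** (≈ 1.604°). -/
theorem slabSplitClass_nonempty_NE39 :
    ∃ Λ : SlabCertificate NE39.splitLurieLinesSystem,
      ∀ k ξ, |ξ - NE39.splitLurieLinesSystem.δs k| ≤ 2 * Real.arctan (7 / 500 : ℝ) → Λ.a k ≤ Real.cos ξ ∧ Real.cos ξ ≤ Λ.b k :=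
  ⟨slabCert, hsecL⟩

/-- **THE RECORD-CLASS SPLIT BRACKET ON THE LOSSY 39-BUS OBJECT, TIGHTENED**: the class of record is NON-EMPTY at
`2·arctan(7/500)` (≈ 1.604°, this file) and EMPTY from `2·arctan(3/200)` (≈ 1.719°, lit-6's rank-19 Gram dual
`NE39LossySplitLinesRecDual`), where the positivity class is still NON-EMPTY (`NE39LossySplitLinesU3o200LPCert`) and itself EMPTY from
`2·arctan(13/800)` (≈ 1.862°, `NE39LossySplitLinesLPDual`): record optimum ∈ [1.604°, 1.719°], positivity optimum ∈ [1.719°, 1.862°]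
(«optimum ∈ [x, y]» reads as TYPED: the class is certified NON-EMPTY at the window x and certified EMPTY at every window ≥ y, so the supremum
of certifiable windows lies in [x, y]; nothing is said about the windows strictly between). -/
theorem splitBrackets_tight_NE39 :
    (∃ Λ : SlabCertificate NE39.splitLurieLinesSystem,
      ∀ k ξ, |ξ - NE39.splitLurieLinesSystem.δs k| ≤ 2 * Real.arctan (7 / 500 : ℝ) → Λ.a k ≤ Real.cos ξ ∧ Real.cos ξ ≤ Λ.b k) ∧
    (∀ γ' : ℝ, 2 * Real.arctan (3 / 200 : ℝ) ≤ γ' → ¬ ∃ Λ : SlabCertificate NE39.splitLurieLinesSystem,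
      ∀ k ξ, |ξ - NE39.splitLurieLinesSystem.δs k| ≤ γ' → Λ.a k ≤ Real.cos ξ ∧ Real.cos ξ ≤ Λ.b k) ∧
    (∃ Λ : LPSlabCertificate NE39.splitLurieLinesSystem,
      ∀ k ξ, |ξ - NE39.splitLurieLinesSystem.δs k| ≤ 2 * Real.arctan (3 / 200 : ℝ) → Λ.a k ≤ Real.cos ξ ∧ Real.cos ξ ≤ Λ.b k) ∧
    (∀ γ' : ℝ, 2 * Real.arctan (13 / 800 : ℝ) ≤ γ' → ¬ ∃ Λ : LPSlabCertificate NE39.splitLurieLinesSystem,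
      ∀ k ξ, |ξ - NE39.splitLurieLinesSystem.δs k| ≤ γ' → Λ.a k ≤ Real.cos ξ ∧ Real.cos ξ ≤ Λ.b k) :=
  ⟨slabSplitClass_nonempty_NE39, NE39LossySplitLinesRecDual.positivityLever_split_NE39.2,
    NE39LossySplitLinesRecDual.positivityLever_split_NE39.1,
    fun γ' hγ' => NE39LossySplitLinesLPDual.lpSplitClass_empty_NE39 γ' (NE39LossySplitLinesLPDual.γ₀_eq ▸ hγ')⟩

/-- The record window of this file lies strictly ABOVE the first record window `2·arctan(1/100)` of `NE39LossySplitLinesSlabCert`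
and strictly BELOW the record ceiling `2·arctan(3/200)`. -/
theorem recordWindow_between :
    2 * Real.arctan (1 / 100 : ℝ) < 2 * Real.arctan (7 / 500 : ℝ) ∧ 2 * Real.arctan (7 / 500 : ℝ) < 2 * Real.arctan (3 / 200 : ℝ) := by
  have h1 : (1 / 100 : ℝ) < 7 / 500 := by norm_num
  have h2 : (7 / 500 : ℝ) < 3 / 200 := by norm_num
  have := Real.arctan_strictMono h1
  have := Real.arctan_strictMono h2
  constructor <;> linarith

end Summit.Ventures.GridStability.Lyapunov.NE39LossySplitLinesU7o500SlabCert

end
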